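import Literature.NumberTheory.Automorphic.KugaLemmaDegreeOne
import HarnessLib

/-!
# Borel's injectivity in degree one, abstract form: a co-closed `1`-cochain with a paired
# primitive vanishes

Topic `NumberTheory/Automorphic`; namespace `Literature.NumberTheory.Automorphic.Kuga.Setup` (the
operator vocabulary of `KugaLemmaDegreeOne`). Theorems only; no analytic structure.

This is the algebra of the injectivity of cuspidal cohomology into the cohomology of the
arithmetic group in the bottom degree (Borel; for `GL₂` the Eichler–Shimura–Harder map,
Harder 1987, §3), separated from its two analytic inputs; the algebra itself is folklore (the
energy argument of Borel–Wallach 2000, II §2, against a primitive instead of a cochain).  In the setting of `Kuga.Setup` — operators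
`π(x_i), ρ(x_i)` on the space `H` of (cusp-form-valued) cochain values, a positive definite
Hermitian form `ip` on `H` — suppose a `1`-cochain `η : ι → H` is CO-CLOSED (`δη = ∑ D̃_i η_i = 0`,
e.g. by Kuga's lemma `coclosed_of_posForm`) and admits a PAIRED PRIMITIVE: an element `Ψ` of some
auxiliary space `H'` (in the application: `V`-valued smooth functions of moderate growth on the
automorphic quotient — NOT square integrable in general, so `Ψ ∉ H`) carrying operators `π'(x_i),
ρ'(x_i)` and a pairing `B : H' → H → ℂ`, additive in the second variable, such that

* `B (π'(x_i) Ψ) y = - B Ψ (π(x_i) y)` — integration by parts of a function of moderate growth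
  against a cusp form (`AutomorphicLieDerivSkewAdjointModerateGrowth`, Borel's lemma), and
  `B (ρ'(x_i) Ψ) y = B Ψ (ρ(x_i) y)` — `ρ(x_i)` self-adjoint for the admissible inner product;
* `ip (η i) y = B (π'(x_i) Ψ) y + B (ρ'(x_i) Ψ) y` for all `y ∈ H` — "`D'_i Ψ = η_i`" read through
  the pairing (the primitive equation `dΨ = η`).

Then `η = 0` (`eq_zero_of_pairedPrimitive`):
`∑_i ⟪η_i, η_i⟫ = ∑_i B (D'_i Ψ) η_i = B Ψ (∑_i D̃_i η_i) = B Ψ (δη) = 0` and positivity.  With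
Kuga's lemma supplying `δη = 0` for equivariant cochains under the Casimir match:
`eq_zero_of_pairedPrimitive_of_isCochain`.  Consequently (contrapositive, as used with
`TwistedQuotient.primitiveClass_eq_zero_iff`): a non-zero harmonic cuspidal `1`-cochain has no
invariant primitive of moderate growth, i.e. its Eichler–Shimura–Harder class is non-zero.

## References

* A. Borel, N. Wallach, *Continuous cohomology, discrete subgroups, and representations of
  reductive groups*, 2nd ed. (2000), II §2 (Prop. 2.3, 2.5; the energy identity) (held)
  [BorelWallach2000].
* A. Borel, *Automorphic forms on SL₂(ℝ)* (1997), 11.12 (2) (the skew-adjointness supplying `hπ`;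
  held) [Borel1997].
* G. Harder, *Eisenstein cohomology of arithmetic groups. The case GL₂*, Invent. Math. 89 (1987),
  §3 (not held; context) [Harder1987].
-/

noncomputable section

open scoped ComplexConjugate BigOperators
open Finset

namespace Literature.NumberTheory.Automorphic

namespace Kuga

namespace Setup

variable {H : Type*} [AddCommGroup H] [Module ℂ H] {ι κ : Type*} {S : Setup H ι κ}
variable {H' : Type*} {ip : H → H → ℂ} {B : H' → H → ℂ}

omit [Module ℂ H] in
/-- Additivity of a pairing in its second variable gives `B Ψ 0 = 0`. [folklore] -/
theorem pairing_zero_right (hB : ∀ Ψ x y, B Ψ (x + y) = B Ψ x + B Ψ y) (Ψ : H') : B Ψ 0 = 0 := by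
  have h := hB Ψ 0 0
  rw [add_zero] at h
  -- `B Ψ 0 = B Ψ 0 + B Ψ 0`
  have h2 : B Ψ 0 + B Ψ 0 = B Ψ 0 + 0 := by rw [add_zero]; exact h.symm
  exact add_left_cancel h2

omit [Module ℂ H] in
/-- Additivity of a pairing in its second variable gives subtractivity. [folklore] -/
theorem pairing_sub_right (hB : ∀ Ψ x y, B Ψ (x + y) = B Ψ x + B Ψ y) (Ψ : H') (x y : H) :
    B Ψ (x - y) = B Ψ x - B Ψ y := by
  have h := hB Ψ (x - y) y
  rw [sub_add_cancel] at h
  rw [h, add_sub_cancel_right]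

omit [Module ℂ H] in
/-- Additivity of a pairing in its second variable gives finite additivity. [folklore] -/
theorem pairing_sum_right (hB : ∀ Ψ x y, B Ψ (x + y) = B Ψ x + B Ψ y) (Ψ : H') {σ : Type*}
    (s : Finset σ) (f : σ → H) : B Ψ (∑ i ∈ s, f i) = ∑ i ∈ s, B Ψ (f i) := by
  classical
  induction s using Finset.induction_on with
  | empty => rw [sum_empty, sum_empty, pairing_zero_right hB]
  | insert a s ha ih => rw [sum_insert ha, sum_insert ha, hB, ih]

variable [Fintype ι]

/-- **Borel's injectivity in degree one, abstract form.** Let `ip` be a positive definite Hermitian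
form on `H`, `η : ι → H` a co-closed `1`-cochain (`δη = 0`), and suppose `η` has a *paired
primitive*: `Ψ ∈ H'` with operators `π', ρ'` on `H'` and a pairing `B : H' → H → ℂ`, additive in
the second variable, such that `B (π'_i Ψ) y = - B Ψ (π_i y)` (integration by parts against cusp
forms), `B (ρ'_i Ψ) y = B Ψ (ρ_i y)` (admissibility) and `ip (η i) y = B (π'_i Ψ) y + B (ρ'_i Ψ) y`
(the primitive equation `D'_i Ψ = η_i`, read through the pairing). Then `η = 0`:
`∑ ⟪η_i, η_i⟫ = B Ψ (δη) = 0`. [folklore] -/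
theorem eq_zero_of_pairedPrimitive (hip : IsPosForm ip)
    (hB : ∀ Ψ x y, B Ψ (x + y) = B Ψ x + B Ψ y) (πp' ρp' : ι → H' → H')
    (hπ : ∀ i Ψ y, B (πp' i Ψ) y = -B Ψ (S.πp i y))
    (hρ : ∀ i Ψ y, B (ρp' i Ψ) y = B Ψ (S.ρp i y))
    {η : ι → H} (hδ : S.deltaOne η = 0) {Ψ : H'}
    (hprim : ∀ i y, ip (η i) y = B (πp' i Ψ) y + B (ρp' i Ψ) y) : η = 0 := by
  -- `⟪η_i, η_i⟫ = B Ψ (D̃_i η_i)`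
  have hterm : ∀ i, ip (η i) (η i) = B Ψ (S.Dt i (η i)) := by
    intro i
    rw [hprim i (η i), hπ, hρ, Dt_apply, pairing_sub_right hB]
    ring
  -- `∑ ⟪η_i, η_i⟫ = B Ψ (δη) = 0`
  have hsum : ∑ i, ip (η i) (η i) = 0 := by
    calc ∑ i, ip (η i) (η i) = ∑ i, B Ψ (S.Dt i (η i)) := Finset.sum_congr rfl fun i _ ↦ hterm i
      _ = B Ψ (S.deltaOne η) := (pairing_sum_right hB Ψ _ _).symm
      _ = 0 := by rw [hδ, pairing_zero_right hB]
  -- positivity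
  have hre : ∑ i, (ip (η i) (η i)).re = 0 := by
    have := congrArg Complex.re hsum
    rwa [Complex.re_sum, Complex.zero_re] at this
  have hnn : ∀ i, 0 ≤ (ip (η i) (η i)).re := fun i ↦ hip.nonneg _
  funext i
  have hi := (Finset.sum_eq_zero_iff_of_nonneg fun i _ ↦ hnn i).1 hre i (Finset.mem_univ i)
  exact hip.eq_zero_of_re_self_eq_zero hi

variable [Fintype κ]

/-- **Borel's injectivity in degree one, from Kuga's lemma.** Under the axioms of `Kuga.Setup`
(`IsLawful`: bracket relations and the Casimir match), with `π(x_i)` skew-adjoint and `ρ(x_i)`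
self-adjoint for the positive definite Hermitian form `ip` on `H`, every `K`-equivariant
`1`-cochain `η` (`IsCochain`) is co-closed (`coclosed_of_posForm`); if it moreover has a paired
primitive in the sense of `eq_zero_of_pairedPrimitive`, then `η = 0`. In words: a harmonic
`1`-cochain of cusp forms with an invariant primitive of moderate growth vanishes, so the
Eichler–Shimura–Harder class of a non-zero one is non-zero (Kuga's lemma: Borel–Wallach 2000, II §2).
[folklore] -/
theorem eq_zero_of_pairedPrimitive_of_isCochain (hS : S.IsLawful) (hip : IsPosForm ip)
    (hπH : ∀ i x y, ip (S.πp i x) y = -ip x (S.πp i y))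
    (hρH : ∀ i x y, ip (S.ρp i x) y = ip x (S.ρp i y))
    (hB : ∀ Ψ x y, B Ψ (x + y) = B Ψ x + B Ψ y) (πp' ρp' : ι → H' → H')
    (hπ : ∀ i Ψ y, B (πp' i Ψ) y = -B Ψ (S.πp i y))
    (hρ : ∀ i Ψ y, B (ρp' i Ψ) y = B Ψ (S.ρp i y))
    {η : ι → H} (hη : S.IsCochain η) {Ψ : H'}
    (hprim : ∀ i y, ip (η i) y = B (πp' i Ψ) y + B (ρp' i Ψ) y) : η = 0 :=
  eq_zero_of_pairedPrimitive hip hB πp' ρp' hπ hρ (coclosed_of_posForm hS hip hπH hρH hη) hprim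

omit [Fintype κ] in
/-- **Contrapositive**: a non-zero co-closed `1`-cochain has no paired primitive. [folklore] -/
theorem not_exists_pairedPrimitive_of_ne_zero (hip : IsPosForm ip)
    (hB : ∀ Ψ x y, B Ψ (x + y) = B Ψ x + B Ψ y) (πp' ρp' : ι → H' → H')
    (hπ : ∀ i Ψ y, B (πp' i Ψ) y = -B Ψ (S.πp i y))
    (hρ : ∀ i Ψ y, B (ρp' i Ψ) y = B Ψ (S.ρp i y))
    {η : ι → H} (hδ : S.deltaOne η = 0) (hη0 : η ≠ 0) :
    ¬ ∃ Ψ : H', ∀ i y, ip (η i) y = B (πp' i Ψ) y + B (ρp' i Ψ) y := by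
  rintro ⟨Ψ, hprim⟩
  exact hη0 (eq_zero_of_pairedPrimitive hip hB πp' ρp' hπ hρ hδ hprim)

end Setup

end Kuga

end Literature.NumberTheory.Automorphic

end
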